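import Summits.Schanuel.Schanuel.Theorems.ZilberEacPerturbedImplicit
import Summits.Schanuel.Schanuel.Theorems.ZilberEacCancellingFibreLimits
import Mathlib.Analysis.SpecialFunctions.ExpDeriv
import HarnessLib

/-!
# The double-cancelling regime: the clean rescaled system and its parameters

Zilber's Exponential-Algebraic Closedness, case ladder (host summit Schanuel, cell `pub-schanuel`,
seat 2, gen 15).  THE FAMILY `W = {x₂ = r₀x₀ + r₁x₁ + c, y₀ = x₀ + y₂F₀(y₂), y₁ = x₁ + y₂F₁(y₂)}`
with `r₀r₁ < 0` and `e₁ = deg F₁ + 1 < e₀ = deg F₀ + 1` (HANDOFF O59 PLAN).  THE DOUBLE-CANCELLING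
ANSATZ: one label `n → ∞` (sign `s = ±1`, branch `j₀`),

  `x₂ = −2πisn + (τ + 2πij₀ + v)/e₀`,  `τ = Log(2πin/(r₀a₀s))`  (so `r₀a₀y₂^{e₀} = 2πisn·e^{v}`),
  `xⱼ = −wⱼ(x₂) + δⱼ`,  `wⱼ = y₂Fⱼ(y₂)`,  `δⱼ = e^{xⱼ}` super-exponentially small.

Dividing the plane equation `x₂ + r₀w₀ + r₁w₁ − c = r₀δ₀ + r₁δ₁` by `2πisn` gives
`clean(p, v) + Δ(v) = 0` with the CLEAN system

  `clean((ν, μ, σ, θ), v) = −1 + e^{v} + ν + μv/e₀ + σR₀(σ, v) + θR₁(σ, v)`,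
  `R₀ = Σ_{i<e₀−1}(A_{0,i}/a₀)σ^{e₀−2−i}ω^{j₀(i+1)}e^{(i+1)v/e₀}`,
  `R₁ = Σ_{i<e₁}A_{1,i}σ^{e₁−1−i}ω^{j₀(i+1)}e^{(i+1)v/e₀}`  (`ω = e^{2πi/e₀}`),

entire with `clean(0, v) = e^{v} − 1`, and the parameters `σ = e^{−τ/e₀}`, `μ = 1/(2πisn)`,
`ν = μ((τ + 2πij₀)/e₀ − c)`, `θ = μr₁e^{e₁τ/e₀}` all `→ 0` (`e₁ < e₀`).

* **`exists_clean_doubleCancelling`** — `exists_zero_of_perturbed_implicit` for `clean`: the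
  clean solution `V(p) → 0`, constants `C, r`, and the persistence of solutions under every
  perturbation `Δ` with `‖Δ‖ ≤ ρ`, `Lip Δ ≤ 1/(2C)` on `B(V p, Cρ)`.
* **`tendsto_params_doubleCancelling`** — `(ν, μ, σ, θ)(n) → 0` (the `K = m`, `β = 1` case of
  `ZilberEacCancellingFibreLimits`).

HONEST FRAMING: preparatory lemmas for explicit members of an OPEN cell (`ECCell 3 2`);
NOT Schanuel's conjecture; EAC ⇏ SC.
-/

noncomputable section

open Complex Filter Topology Metric Set

set_option linter.dupNamespace false

namespace Summit.Schanuel.Schanuel.Theorems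

section Clean

/-- **The clean double-cancelling system and its persistence under small Lipschitz perturbations.**
See the module docstring. (new) -/
theorem exists_clean_doubleCancelling (e₀ e₁ : ℕ) (A : Fin 2 → ℕ → ℂ) (a₀ ω : ℂ) (j₀ : ℕ) :
    ∃ (V : ℂ × ℂ × ℂ × ℂ → ℂ) (C r : ℝ), 0 < C ∧ 0 < r ∧ Tendsto V (𝓝 0) (𝓝 0) ∧
      (∀ᶠ p in 𝓝 (0 : ℂ × ℂ × ℂ × ℂ),
        -1 + exp (V p) + p.1 + p.2.1 * V p / (e₀ : ℂ) +
          p.2.2.1 * (∑ i ∈ Finset.range (e₀ - 1), A 0 i / a₀ * p.2.2.1 ^ (e₀ - 2 - i) *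
            ω ^ (j₀ * (i + 1)) * exp ((((i : ℕ) : ℂ) + 1) * V p / (e₀ : ℂ))) +
          p.2.2.2 * (∑ i ∈ Finset.range e₁, A 1 i * p.2.2.1 ^ (e₁ - 1 - i) *
            ω ^ (j₀ * (i + 1)) * exp ((((i : ℕ) : ℂ) + 1) * V p / (e₀ : ℂ))) = 0) ∧
      ∀ᶠ p in 𝓝 (0 : ℂ × ℂ × ℂ × ℂ), ∀ ρ : ℝ, 0 < ρ → ρ ≤ r → ∀ Δ : ℂ → ℂ,
        (∀ v ∈ closedBall (V p) (C * ρ), ‖Δ v‖ ≤ ρ) →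
        (∀ v ∈ closedBall (V p) (C * ρ), ∀ v' ∈ closedBall (V p) (C * ρ),
            ‖Δ v - Δ v'‖ ≤ (1 / (2 * C)) * ‖v - v'‖) →
        ∃ v ∈ closedBall (V p) (C * ρ),
          -1 + exp v + p.1 + p.2.1 * v / (e₀ : ℂ) +
            p.2.2.1 * (∑ i ∈ Finset.range (e₀ - 1), A 0 i / a₀ * p.2.2.1 ^ (e₀ - 2 - i) *
              ω ^ (j₀ * (i + 1)) * exp ((((i : ℕ) : ℂ) + 1) * v / (e₀ : ℂ))) +
            p.2.2.2 * (∑ i ∈ Finset.range e₁, A 1 i * p.2.2.1 ^ (e₁ - 1 - i) *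
              ω ^ (j₀ * (i + 1)) * exp ((((i : ℕ) : ℂ) + 1) * v / (e₀ : ℂ))) + Δ v = 0 := by
  set f : (ℂ × ℂ × ℂ × ℂ) × ℂ → ℂ := fun q =>
    -1 + exp q.2 + q.1.1 + q.1.2.1 * q.2 / (e₀ : ℂ) +
      q.1.2.2.1 * (∑ i ∈ Finset.range (e₀ - 1), A 0 i / a₀ * q.1.2.2.1 ^ (e₀ - 2 - i) *
        ω ^ (j₀ * (i + 1)) * exp ((((i : ℕ) : ℂ) + 1) * q.2 / (e₀ : ℂ))) +
      q.1.2.2.2 * (∑ i ∈ Finset.range e₁, A 1 i * q.1.2.2.1 ^ (e₁ - 1 - i) *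
        ω ^ (j₀ * (i + 1)) * exp ((((i : ℕ) : ℂ) + 1) * q.2 / (e₀ : ℂ))) with hf
  have hfC : ContDiff ℂ 1 f := by
    rw [hf]
    fun_prop
  have hfq : f (0, 0) = 0 := by simp [hf]
  have hL : HasFDerivAt (fun v : ℂ => f (0, v)) (ContinuousLinearMap.id ℂ ℂ) 0 := by
    have heq : (fun v : ℂ => f (0, v)) = fun v => -1 + exp v := by
      funext v
      simp [hf]
    rw [heq]
    have h := ((Complex.hasDerivAt_exp (0 : ℂ)).const_add (-1 : ℂ)).hasFDerivAt
    rw [Complex.exp_zero] at h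
    refine h.congr_fderiv ?_
    ext
    simp
  have hinj : Function.Injective (ContinuousLinearMap.id ℂ ℂ) := fun a b h => by simpa using h
  obtain ⟨V, C, r, hC, hr, hV, hclean, hpert⟩ := exists_zero_of_perturbed_implicit hfC hfq hL hinj
  refine ⟨V, C, r, hC, hr, hV, ?_, ?_⟩
  · filter_upwards [hclean] with p hp
    simpa [hf] using hp
  · filter_upwards [hpert] with p hp ρ hρ hρr Δ hΔ hΔlip
    obtain ⟨v, hv, hsol⟩ := hp ρ hρ hρr Δ hΔ hΔlip
    exact ⟨v, hv, by simpa [hf] using hsol⟩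

end Clean

section Params

/-- **The four parameters of the double-cancelling system tend to zero** along `n → ∞`:
`σ = e^{−τ/e₀}`, `μ = 1/(2πisn)`, `ν = μ((τ + 2πij₀)/e₀ − c)`, `θ = μr₁e^{e₁τ/e₀}` with
`τ = Log(2πin/(r₀a₀s))`, `s = ±1`, `e₁ < e₀`. (new) -/
theorem tendsto_params_doubleCancelling (e₀ : ℕ) (he₀ : 1 ≤ e₀) (e₁ : ℕ) (he : e₁ < e₀)
    {r₀ : ℝ} (hr₀ : r₀ ≠ 0) {a₀ : ℂ} (ha₀ : a₀ ≠ 0) (r₁ : ℝ) (c : ℂ) (s : ℝ) (hs : s = 1 ∨ s = -1)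
    (j₀ : ℕ) :
    Tendsto (fun n : ℕ =>
      ((((2 * Real.pi * I * (s : ℂ) * (n : ℂ))⁻¹ *
          ((Complex.log (2 * Real.pi * I * (n : ℂ) / ((r₀ : ℂ) * (a₀ * s))) + 2 * Real.pi * I * j₀) /
            (e₀ : ℂ) - c)),
        (2 * Real.pi * I * (s : ℂ) * (n : ℂ))⁻¹,
        exp (-(Complex.log (2 * Real.pi * I * (n : ℂ) / ((r₀ : ℂ) * (a₀ * s)))) / (e₀ : ℂ)),
        (2 * Real.pi * I * (s : ℂ) * (n : ℂ))⁻¹ * (r₁ : ℂ) *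
          exp ((e₁ : ℂ) * Complex.log (2 * Real.pi * I * (n : ℂ) / ((r₀ : ℂ) * (a₀ * s))) /
            (e₀ : ℂ))) : ℂ × ℂ × ℂ × ℂ)) atTop (𝓝 0) := by
  have hs0 : (s : ℂ) ≠ 0 := by
    rcases hs with h | h <;> simp [h]
  have has : a₀ * (s : ℂ) ≠ 0 := mul_ne_zero ha₀ hs0
  -- the label sandwich with `K = m`, `β = 1`
  have hK : ∀ m : ℕ, (m : ℝ) ^ (1 : ℝ) ≤ (m : ℝ) ∧ (m : ℝ) ≤ (m : ℝ) ^ (1 : ℝ) + 1 := fun m => by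
    rw [Real.rpow_one]; exact ⟨le_rfl, by linarith⟩
  have hβ : (0 : ℝ) < 1 := one_pos
  -- the four limits from `ZilberEacCancellingFibreLimits`
  have hμ₀ := tendsto_param_mu (K := fun m : ℕ => (m : ℝ)) hβ hK
  have hσ := tendsto_param_sigma (K := fun m : ℕ => (m : ℝ)) hβ hK hr₀ has e₀ he₀
  have hν₀ := tendsto_param_nu (K := fun m : ℕ => (m : ℝ)) hβ hK hr₀ has e₀ he₀ 0
    (c - 2 * Real.pi * I * j₀ / (e₀ : ℂ))
  have hθ₀ := tendsto_param_theta (K := fun m : ℕ => (m : ℝ)) hβ hK hr₀ has e₀ he₀ e₁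
    (by rw [one_mul]; exact_mod_cast he)
  -- rescale by the constants `s⁻¹` and `r₁`
  have hinv : ∀ n : ℕ, (2 * Real.pi * I * (s : ℂ) * (n : ℂ))⁻¹ =
      (s : ℂ)⁻¹ * (2 * Real.pi * I * ((n : ℝ) : ℂ))⁻¹ := by
    intro n
    rw [← mul_inv]
    congr 1
    push_cast
    ring
  have hμ : Tendsto (fun n : ℕ => (2 * Real.pi * I * (s : ℂ) * (n : ℂ))⁻¹) atTop (𝓝 0) := by
    have h := hμ₀.const_mul (s : ℂ)⁻¹
    rw [mul_zero] at h
    refine h.congr fun n => ?_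
    rw [hinv]
  have hν : Tendsto (fun n : ℕ => (2 * Real.pi * I * (s : ℂ) * (n : ℂ))⁻¹ *
      ((Complex.log (2 * Real.pi * I * (n : ℂ) / ((r₀ : ℂ) * (a₀ * s))) + 2 * Real.pi * I * j₀) /
        (e₀ : ℂ) - c)) atTop (𝓝 0) := by
    have h := hν₀.const_mul (s : ℂ)⁻¹
    rw [mul_zero] at h
    refine h.congr fun n => ?_
    rw [hinv]
    push_cast
    ring
  have hθ : Tendsto (fun n : ℕ => (2 * Real.pi * I * (s : ℂ) * (n : ℂ))⁻¹ * (r₁ : ℂ) *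
      exp ((e₁ : ℂ) * Complex.log (2 * Real.pi * I * (n : ℂ) / ((r₀ : ℂ) * (a₀ * s))) /
        (e₀ : ℂ))) atTop (𝓝 0) := by
    have h := hθ₀.const_mul ((s : ℂ)⁻¹ * (r₁ : ℂ))
    rw [mul_zero] at h
    refine h.congr fun n => ?_
    rw [hinv]
    push_cast
    ring
  have hσ' : Tendsto (fun n : ℕ =>
      exp (-(Complex.log (2 * Real.pi * I * (n : ℂ) / ((r₀ : ℂ) * (a₀ * s)))) / (e₀ : ℂ)))
      atTop (𝓝 0) := by
    refine hσ.congr fun n => ?_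
    push_cast
    ring_nf
  have h := hν.prodMk_nhds (hμ.prodMk_nhds (hσ'.prodMk_nhds hθ))
  rw [show (0 : ℂ × ℂ × ℂ × ℂ) = ((0 : ℂ), (0 : ℂ), (0 : ℂ), (0 : ℂ)) from rfl]
  exact h

end Params

end Summit.Schanuel.Schanuel.Theorems

end
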